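import Summits.SmoothPoincare4.SmoothPoincare4.Theses.TransparentBalls
import Literature.Geometry.Riemannian.NonTrappingConvexSublevel
import Literature.Topology.FourManifolds.CerfGammaFour
import HarnessLib.Audit

/-!
# Birth skeleton (BC3) — crux `TransparentSpheresStandard` (stmt-SmoothPoincare4-7264), route `TransparentBalls`

`Cruxes/TransparentSpheresStandard/Lines/birth.lean` · registrar planner-skel-stmt-SmoothPoincare4-7264-0 ·
2026-08-17 · mode skeleton-register (route re-audit bin REPAIRABLE).  The crux is FIXED and is
concluded BY NAME:

  `Summit.SmoothPoincare4.SmoothPoincare4.Theses.TransparentBalls.TransparentSpheresStandard`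

= RIGID_Σ of the route (card RIGID₄, "fake 4-balls trap light"): a homotopy 4-sphere `Σ` with a
TRANSPARENT chart-puncture — a Riemannian metric `g` (with Levi-Civita connection), a closed ROUND
CHART BALL `E = (extChartAt p)⁻¹(closedBall r)`, a smooth `ρ` with `{0 ≤ ρ} = E`, `0` regular,
`∂D = {ρ = 0}` strictly `g`-convex from `D = {ρ ≤ 0} = Σ ∖ E°` and `D` non-trapping — is
diffeomorphic to `S⁴`.  (In the tree's vocabulary the last two hypotheses are VERBATIM
`Literature.Geometry.Riemannian.IsStrictlyConvexSublevel g ρ` and `IsNonTrappingSublevel g ρ`,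
`NonTrappingConvexSublevel.lean`, `Iff.rfl`; the stubs below use the named predicates.)

## The cut — through the DEGREE-1 RUNG of the route's own transparency ladder

The route's thesis (file header, "Why this line") grades transparency by the fibre-degree of an
ESCAPE FUNCTION `f ∈ C^∞(SD)`, `X f > 0` (Paternain–Salo–Uhlmann 2023 = PSU, Prop. 3.3.1:
non-trapping with strictly convex boundary ⟺ such `f` exists).  Degree 1, `f(x,v) = g(V_x, v)`,
means an outward `g`-EXPANDING vector field `V` (`g(∇_w V, w) > 0` on `D`, `dρ(V) > 0` on `∂D`),
and that rung is RIGID: the route's support item `ExpandingFieldTwisted` (stmt-SmoothPoincare4-7267)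
says an expanding pair makes `Σ` a twisted sphere `D⁴ ∪_φ D⁴` (flow of `−V`: unique nondegenerate
source, `V`-flow-out collar, `D ≅ D⁴`, `Σ = D ∪_{S³} E`), whence `Σ ≅ S⁴` by Cerf's `Γ₄ = 0`.
"RIGID_Σ is the claim that arbitrary degree is as rigid as degree 1" (route header) — so the
skeleton is exactly that sentence, typed, in three stubs, each handing over a different object
(expanding pair `(g′, V)` ↦ `IsTwistedSphere 3 φ Σ` ↦ `Σ ≃ₘ S⁴`):

* `stub_expandingPair` (OPEN — the heart; RIGID_Σ transferred to its degree-1 certificate):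
  every transparent chart-puncture `D = {ρ ≤ 0}` of a homotopy 4-sphere carries, for SOME smooth
  Riemannian metric `g′` on `Σ` (with Levi-Civita connection; `g′ = g` is NOT required), a smooth
  vector field `V` which is `g′`-expanding on `D` and points out of `D` along `∂D` — the hypotheses
  of `ExpandingFieldTwisted` for the SAME `(Σ, p, r, ρ)`.  Status: equivalent to "transparent ⇒
  `D ≅ B⁴` rel the chart sphere" modulo theorems on both sides (⇐: pull back the flat metric and the
  radial field `y·∂_y` along `D ≅ B⁴`, blend outside a collar — metrics form a convex cone; ⇒:
  `ExpandingFieldTwisted` + Palais' disc theorem), hence to the route's planned layer-2 node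
  `RigidTwisted` (header, TWO-LAYER PLAN, first split) and to the crux modulo Cerf/Palais — a
  genuine transfer `C⁺`, NOT the crux reworded: the crux speaks of the closed manifold `Σ`, the stub
  of an analytic certificate `(g′, V)` on the compact domain `D`, and neither cheap probe
  `stub → crux`, `stub → SmoothPoincare4` succeeds (BC3, below).  WHY EASIER / what the transfer
  exposes: (i) the conclusion is an OPEN condition on `(g′, V)` (`C¹`-open in `V`, `C¹`-open in
  `g′`), so it is reachable by a CONTINUITY METHOD along a path of metrics `g_t` from the given
  transparent `g` — transparency (convex + non-trapping) is itself `C²`-open (route header) and the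
  set of `t` carrying an expanding pair is open; the whole difficulty is closedness, i.e. an a-priori
  bound on the expansion rate, which is where lens/scattering rigidity of transparent metrics
  (StefanovUhlmannVasy2021 = arXiv:1702.03638, Guillarmou2016 = arXiv:1412.1760) can bite;
  (ii) the SAME-METRIC strengthening "`g` transparent ⇒ `g` itself admits an expanding `V`"
  (= "every transparent metric has a DEGREE-1 escape function") is the sharp conjecture of the
  ladder and the first thing a refuter should test on lens-shaped non-simple transparent discs
  (flat disc with a focusing spherical cap `<` hemisphere: transparent, with conjugate points) — it
  is deliberately NOT the registered stub (a false sharpening would kill the line for the wrong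
  reason), but any proof of it proves the stub with `g′ = g`; (iii) the known rungs any attack must
  first reproduce: `K ≤ 0` on `D` / no conjugate points ⇒ simple ⇒ ball (PSU Prop. 3.8.5; tree:
  `Literature.Geometry.Riemannian.PaternainSaloUhlmann2023_simple_sublevel_ball`, interior form) and
  `K ≥ 0` with convex boundary (soul argument).  Why it might fail: an exotic homotopy 4-ball
  carrying a transparent metric (route header, crux why-it-might-fail) refutes it — together with
  the crux and nothing less.  [PaternainSaloUhlmann2023 Prop. 3.3.1, 3.7.22, 3.8.5;
  arXiv:1702.03638; arXiv:1412.1760; arXiv:1108.4938; Milnor1965 §9]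
* `stub_expandingTwisted` — BY NAME the route's support item `ExpandingFieldTwisted`
  (stmt-SmoothPoincare4-7267; kind support, rank 9, difficulty XL, grounded NEW 2026-08-15):
  DEGREE-1 TRANSPARENCY IS RIGID — an expanding pair `(g, V)` on the chart-puncture `D` with `V`
  outward on `∂D` makes `Σ` a twisted sphere `D⁴ ∪_φ D⁴` (`IsTwistedSphere 3 φ S.carrier`).  A
  theorem-sized lemma (Milnor's flow-out argument; no convexity needed), not bookkeeping; proving it
  closes a route item.  [Milnor1965 §9, KervaireMilnor1963 §1, PaternainSaloUhlmann2023 Prop. 3.3.1]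
* `stub_cerf` — BY NAME the named fact `Literature.Topology.FourManifolds.cerf_twistedSphere_four`
  (Cerf 1968, `Γ₄ = 0`, twisted-sphere form: every `D⁴ ∪_φ D⁴` is diffeomorphic to `S⁴`; the
  route header's planned child `CerfGammaFour`; a THEOREM, tier-0 formalisation debt XL, shared
  with SchoenfliesSplit's `SchsplitCerf` (stmt-SmoothPoincare4-8758, `Iff.rfl`-equivalent by its
  `Disproof.lean`) and with the birth skeletons of `RungFour` / `SbdSchoenflies`).
  [Cerf1968, KervaireMilnor1963 §1]

`TransparentSpheresStandard_of : Sig.stub_expandingPair → Sig.stub_expandingTwisted →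
Sig.stub_cerf → TransparentSpheresStandard` is PROVED (§3, a few lines of logic: certificate ↦
twisted sphere ↦ Cerf, bundling `S.carrier` as a `TwistedSphere 3 φ`); the `Sig.stub_*`
propositions are the single source of truth for the three signatures (their last name component is
the stub name, so the skeleton audit reads the hypotheses of `_of` as the declared stubs).
`lean check --json`: rc 0, sorries ONLY in the three `stub_*` (sorry count 3 = stub count, zero
elsewhere; audit block quoted in the registrar's NOTES.md and the crux evidence note).

Hardest stub: `stub_expandingPair` (open; it is RIGID_Σ seen through its degree-1 certificate).
`stub_expandingTwisted` / `stub_cerf` are theorems (XL formalisation each).  A refutation of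
`stub_expandingPair` is a transparent exotic homotopy 4-ball: it refutes the crux and, with the
sibling crux `PuncturedSpheresTransparent` (TRANSP_Σ) standing, `SmoothPoincare4` — informative
either way (route KILL CRITERIA).

BC3 probes (registrar, 2026-08-17, files `bc/probe_stub_*.lean` of the registrar's folder,
importing only the route file + the two Literature files above): for each of the three stub
signatures `T`, `example : T → TransparentSpheresStandard` and `example : T → SmoothPoincare4` by
`first | exact? | simpa | aesop` (and once more after `unfold`ing the target) FAIL — no stub is
cheaply the crux or the summit; raw results in the registrar's NOTES.md / crux evidence note.

Disproof used: none exists for this crux (`ledger crux ls stmt-SmoothPoincare4-7264`: no workfiles,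
no `Disproof.lean`, no `Theorems/TransparentSpheresStandard/Negative/*`, 2026-08-17); negatives
index of the summit: 0 refuted statements (2026-08-17).  The refuter's statement audit
(2026-08-15: ELABORATES; encodings of chart-ball puncture, convexity sign, non-trapping audited
clean) and the grounder's stamp (NEW / open-problem; conjugate-free rung in tree) are honoured: the
crux is used verbatim and concluded by name; no stub is an instance of a refuted statement (there
are none).

Sources: PaternainSaloUhlmann2023 (Def. 3.1.3, 3.1.7, Lemma 3.1.12, Prop. 3.3.1, 3.7.22, 3.8.5),
StefanovUhlmannVasy2021 (arXiv:1702.03638), Guillarmou2016 (arXiv:1412.1760), CrokeHerreros2016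
(arXiv:1108.4938), Cerf1968 (Γ₄ = 0), KervaireMilnor1963 §1, Milnor1965 §9, Kirby1997 Problem 4.89.
-/

noncomputable section

-- every `Summit.SmoothPoincare4.SmoothPoincare4.…` name repeats the summit = sub-problem segment
-- (D-0017 layout); the duplicate is deliberate.
set_option linter.dupNamespace false
set_option linter.unusedVariables false

namespace Summit.SmoothPoincare4.SmoothPoincare4.Cruxes.TransparentSpheresStandard.Birth

open scoped Manifold ContDiff Topology
open Set Function
open Literature.Geometry.Lorentzian (PseudoRiemannianMetric)
open Literature.Geometry.Riemannian (IsStrictlyConvexSublevel IsNonTrappingSublevel)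
open Literature.Topology.FourManifolds (HomotopySphere IsTwistedSphere TwistedSphere
  cerf_twistedSphere_four)
open Summit.SmoothPoincare4.SmoothPoincare4.Theses.TransparentBalls (TransparentSpheresStandard
  ExpandingFieldTwisted)

/-- Local notation: the model space `ℝ⁴`. -/
local notation "𝔼⁴" => EuclideanSpace ℝ (Fin 4)
/-- Local notation: the round `4`-sphere `S⁴ ⊆ ℝ⁵` (model `𝓡 4`), target of the crux. -/
local notation "𝕊⁴" => (Metric.sphere (0 : EuclideanSpace ℝ (Fin 5)) 1)

/-! ## §1 The three stub signatures (single source of truth; last name component = stub name) -/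

/-- **STUB 1 — EVERY TRANSPARENT CHART-PUNCTURE CARRIES AN EXPANDING PAIR** (OPEN — the heart;
RIGID_Σ transferred to its degree-1 certificate).  For every homotopy 4-sphere `Σ = S.carrier`,
smooth Riemannian `g` with Levi-Civita connection, chart centre `p`, radius `r > 0` with
`closedBall (chart p p) r ⊆ chart target`, smooth `ρ` with `{0 ≤ ρ} =` the chart-preimage of that
closed ball, such that `D = {ρ ≤ 0}` is a strictly convex regular sublevel domain
(`IsStrictlyConvexSublevel g ρ`: `dρ ≠ 0` and `Hess_g ρ > 0` on `ker dρ` along `{ρ = 0}`) and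
non-trapping (`IsNonTrappingSublevel g ρ`: every `g`-geodesic starting in `D` with non-zero velocity
reaches `{ρ > 0}` in positive time) — i.e. EXACTLY the hypotheses of the crux — there exist a smooth
Riemannian metric `g′` on `Σ` with Levi-Civita connection and a smooth vector field `V` on `Σ`
(smooth as a section of `TΣ`) such that `g′(∇′_w V, w) > 0` for every `x ∈ D` and `w ≠ 0`
(`½ 𝓛_V g′` positive definite on `D`) and `dρ(V) > 0` on `∂D = {ρ = 0}` (`V` points out of `D`) —
EXACTLY the extra hypotheses of the route's support item `ExpandingFieldTwisted` for the same
`(Σ, p, r, ρ)`.  The metric may change (`g′ ≠ g` allowed): the same-metric version ("every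
transparent metric has a degree-1 escape function `f(x,v) = g(V_x,v)`") is the sharper, riskier
conjecture and is not registered.  Equivalent, modulo `ExpandingFieldTwisted` + Palais (⇒) and
pull-back of the flat ball metric with its radial field (⇐), to "transparent ⇒ `D ≅ B⁴` rel `∂`",
the route's planned node `RigidTwisted`; why-easier: an OPEN condition on `(g′, V)`, reachable by a
continuity method in the metric from the given transparent `g`, closedness being an a-priori
expansion bound where lens/scattering rigidity can act.  Why it might fail: a transparent metric
on an exotic homotopy 4-ball (then the crux fails too).
Sources: PaternainSaloUhlmann2023 Prop. 3.3.1 / 3.7.22 / 3.8.5, arXiv:1702.03638, arXiv:1412.1760,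
arXiv:1108.4938, Milnor1965 §9.  Size: open problem. -/
def Sig.stub_expandingPair : Prop :=
  ∀ (S : HomotopySphere 4)
    (g : PseudoRiemannianMetric (𝓡 4) ∞ 𝔼⁴ (TangentSpace (𝓡 4) : S.carrier → Type _))
    [g.HasLeviCivita] (p : S.carrier) (r : ℝ) (ρ : S.carrier → ℝ),
    g.IsRiemannian → ContMDiff (𝓡 4) 𝓘(ℝ, ℝ) ∞ ρ → 0 < r →
    Metric.closedBall (extChartAt (𝓡 4) p p) r ⊆ (extChartAt (𝓡 4) p).target →
    {x | 0 ≤ ρ x} = (extChartAt (𝓡 4) p).symm '' Metric.closedBall (extChartAt (𝓡 4) p p) r →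
    IsStrictlyConvexSublevel g ρ → IsNonTrappingSublevel g ρ →
    ∃ (g' : PseudoRiemannianMetric (𝓡 4) ∞ 𝔼⁴ (TangentSpace (𝓡 4) : S.carrier → Type _))
      (_ : g'.HasLeviCivita) (V : Π x : S.carrier, TangentSpace (𝓡 4) x),
      g'.IsRiemannian ∧ ContMDiff (𝓡 4) (𝓡 4).tangent ∞ (T% V) ∧
      (∀ x, ρ x ≤ 0 → ∀ w : TangentSpace (𝓡 4) x, w ≠ 0 → 0 < g'.val x (g'.leviCivita V x w) w) ∧
      (∀ x, ρ x = 0 → (0 : ℝ) < (mfderiv (𝓡 4) 𝓘(ℝ, ℝ) ρ x (V x) : ℝ))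

/-- **STUB 2 — DEGREE-1 TRANSPARENCY IS RIGID** — BY NAME the route's support item
`ExpandingFieldTwisted` (stmt-SmoothPoincare4-7267): if the chart-puncture `D = {ρ ≤ 0}` (co-ball,
`0` regular) of a homotopy 4-sphere carries a smooth vector field `V` with `g(∇_w V, w) > 0` on `D`
(`w ≠ 0`) and `dρ(V) > 0` on `∂D`, then `Σ` is a twisted sphere `D⁴ ∪_φ D⁴`.  Proof sketch (route
item): `−V` preserves `D` and contracts intrinsic lengths exponentially, so `D` shrinks to a unique
nondegenerate source `x₀`; a small chart sphere around `x₀` is `V`-transverse and its flow-out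
reaches `∂D` transversally in finite time, so `D =` ball `∪` collar `≅ D⁴` and `Σ = D ∪_{S³} E`.
A THEOREM (difficulty XL as typed), not bookkeeping.  Why it might fail (as a lemma): only the
encoding (`T% V` smoothness, `g.leviCivita V x w = ∇_w V`).
Sources: Milnor1965 §9, KervaireMilnor1963 §1, PaternainSaloUhlmann2023 Prop. 3.3.1. -/
abbrev Sig.stub_expandingTwisted : Prop :=
  ExpandingFieldTwisted

/-- **STUB 3 — CERF'S `Γ₄ = 0` IN TWISTED-SPHERE FORM** — BY NAME the named fact
`Literature.Topology.FourManifolds.cerf_twistedSphere_four`: every bundled twisted 4-sphere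
`T : TwistedSphere 3 φ` has `T.carrier ≃ₘ S⁴`.  A THEOREM (Cerf 1968; Kervaire–Milnor 1963 §1),
tier-0 formalisation debt XL, staffed elsewhere (SchoenfliesSplit `SchsplitCerf`,
stmt-SmoothPoincare4-8758, ↔ this fact).  Why it might fail (as a lemma): only the
`TwistedSphere` / `IsBoundaryGluing` typing.  Sources: Cerf1968, KervaireMilnor1963 §1. -/
abbrev Sig.stub_cerf : Prop :=
  cerf_twistedSphere_four

/-! ## §2 The registered stubs (the ONLY `sorry`s of this file) -/

/-- Registered stub 1 (OPEN, hardest, the crux's heart): transparent chart-punctures carry an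
expanding pair.  See `Sig.stub_expandingPair`. -/
theorem stub_expandingPair : Sig.stub_expandingPair := by
  sorry

/-- Registered stub 2 (theorem-sized, XL): the route's support item `ExpandingFieldTwisted` by
name.  See `Sig.stub_expandingTwisted`. -/
theorem stub_expandingTwisted : Sig.stub_expandingTwisted := by
  sorry

/-- Registered stub 3 (theorem of Cerf, XL formalisation debt): `cerf_twistedSphere_four` by name.
See `Sig.stub_cerf`. -/
theorem stub_cerf : Sig.stub_cerf := by
  sorry

/-! ## §3 The composition — the crux BY NAME from the three stubs (real proof, no `sorry`) -/

/-- **Skeleton theorem.**  Expanding-pair existence, degree-1 rigidity and Cerf imply the crux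
`Theses.TransparentBalls.TransparentSpheresStandard` BY NAME.  Fix the data of the crux
(`Σ`, transparent `g`, chart ball, `ρ`).  Stub 1 supplies a metric `g′` with Levi-Civita connection
and a `g′`-expanding field `V` on `D`, outward on `∂D`; stub 2 (with `g′` in place of `g`: the
co-ball hypotheses do not mention the metric) presents `Σ` as a twisted sphere `D⁴ ∪_φ D⁴`; stub 3
(Cerf), applied to `Σ` bundled as a `TwistedSphere 3 φ` (the `Fact` instance
`isSmoothEmbedding_sphereInclusion' 3` is the tree's global one, ClosedBall.lean), gives
`Σ ≃ₘ S⁴`. -/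
theorem TransparentSpheresStandard_of :
    Sig.stub_expandingPair → Sig.stub_expandingTwisted → Sig.stub_cerf →
      TransparentSpheresStandard := by
  intro hPair hTw hCerf S g _ p r ρ hRiem hρ hr hball hlevel hreg hconv hnt
  -- stub 1: an expanding pair `(g', V)` on the transparent puncture `D = {ρ ≤ 0}`
  obtain ⟨g', hLC', V, hRiem', hV, hexp, hout⟩ :=
    hPair S g p r ρ hRiem hρ hr hball hlevel ⟨hreg, hconv⟩ hnt
  haveI : g'.HasLeviCivita := hLC'
  -- stub 2: degree-1 transparency is rigid — `Σ` is a twisted sphere `D⁴ ∪_φ D⁴`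
  obtain ⟨φ, hφ⟩ := hTw S g' p r ρ V hRiem' hρ hr hball hlevel hreg hV hexp hout
  -- stub 3: Cerf's `Γ₄ = 0` on `Σ` bundled as a twisted sphere
  exact hCerf φ ⟨S.carrier, hφ⟩

/-- The crux by name, closed modulo the three registered stubs (its axiom closure contains
`sorryAx` through the stubs only; `TransparentSpheresStandard_of` itself is sorry-free). -/
theorem transparentSpheresStandard_of_stubs : TransparentSpheresStandard :=
  TransparentSpheresStandard_of stub_expandingPair stub_expandingTwisted stub_cerf

end Summit.SmoothPoincare4.SmoothPoincare4.Cruxes.TransparentSpheresStandard.Birth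

end
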